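import Summits.BirchSwinnertonDyer.Rank1Residual.ManinAdditive.KummerDiamondReciprocity
import Literature.NumberTheory.EllipticCurves.ModularParametrizationCuspGalois
import Mathlib.NumberTheory.Cyclotomic.Basic
import Mathlib.FieldTheory.Galois.Basic
import Mathlib.RingTheory.RootsOfUnity.Complex
import Mathlib.RingTheory.RootsOfUnity.Minpoly
import HarnessLib
import HarnessLib.Audit.Tags

/-!
# The Atkin–Lehner cusp values `R_Q = φ₀(1/y)` of a lattice-optimal `X₀(N)`-parametrisation are rational
# (cell `bsd-f2-manin`, seat `-es` g39, MEMO-es §60.1 (D3) / §60.2 (4); LEAD line `kummer_diamond`, stub D3)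

Add-on to the landed `…ManinAdditive.KummerDiamondReciprocity` (T-es-77, p760288 = §§1–3 of the es g39 sketch): this file is
its §4.  For an elliptic `W₀/ℚ` with a LATTICE-OPTIMAL `X₀(N)`-datum `D₀` (`Λ_E = c₀·Λ_f`) and every unitary divisor
`y ∣ N` (`N = Q·y`, `gcd(Q, y) = 1`), the cusp value `R_Q := π₀(c₀·{∞,1/y}_f)` is (the base change of) a point of `W₀(ℚ)`
— `uniformize_modularSymbol_inv_unitary_rational`, modulo the landed named fact
`optimalParametrization_cusp_cyclotomic_galois` (Stevens 1982 Thm. 1.3.1 (a)(b) on Shimura's model of `X₀(N)`,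
`Literature/NumberTheory/EllipticCurves/ModularParametrizationCuspGalois.lean`) ONLY.  Proof = Galois descent from `ℚ(ζ_N)`:
the fact gives `P ∈ W₀(ℚ(ζ_N))` over `R_Q` and, for `τ_d : ζ_N ↦ ζ_N^d`, `τ_d(P)` over `π₀(c₀·{∞,1/(d′y)}_f)`; the transport
lemma `exists_gamma0_cusp_transport` (landed §1) gives `γ₀ ∈ Γ₀(N)` with `γ₀·(1/y) = 1/(d′y)` exactly, so by Manin's relation
`{∞,1/(d′y)} − {∞,1/y} = {∞,γ₀∞} ∈ Λ_f` and `c₀Λ_f ⊆ Λ_E`: `τ_d(P) = P` for every `τ_d`; `ℚ(ζ_N)/ℚ` is Galois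
(`isCyclotomicExtension_cyclotomicSubfield`: `ℚ(ζ_N) ⊂ ℂ` IS an `N`-th cyclotomic extension — Mathlib's
`IsPrimitiveRoot.intermediateField_adjoin_isCyclotomicExtension` asks for `Algebra.IsIntegral ℚ ℂ`, so its three-line proof is
replayed with `adjoin_simple_toSubalgebra_of_isAlgebraic`), hence the coordinates of `P` are rational
(`IsGalois.mem_range_algebraMap_iff_fixed`) and `P` descends to `W₀(ℚ)`.  Ogg 1973 / Stevens: the cusp `1/y` of `X₀(N)` is
defined over `ℚ(ζ_{gcd(y, N/y)}) = ℚ`.  Numerical witness (MEMO-es §60.3, kit j338238): `R_Q` is a rational torsion point in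
75/75 (class, Q) pairs of the E15 gain classes `N ≤ 130`.  HONEST FRAMING: conditional on the named printed fact; torsion of
`R_Q` (Manin–Drinfeld) is not restated; E-es-185, C2 `ManinOddAtFour`, Manin's conjecture and BSD are NOT proved here.  No sorry.

TYPER NOTE (typer g21, T-es-78).  SOURCE = HOME/es/g39/KummerDiamondCuspRationality-es-g39.lean sha16 13e75393d15fd8be (153 l.; es: farm rc 0 · 0 err ·
0 warn · 0 sorry; MEMO-es §60 §4 = LEAD stub D3; evidence #60 on 22967) VERBATIM (this note is the only delta).  CONE SIDE by construction: it imports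
the landed cone-side module `…ManinAdditive.KummerDiamondReciprocity` (T-es-77, p760288) + the Literature fact file `ModularParametrizationCuspGalois`
(X₀ form of Stevens 1982 Thm 1.3.1, named fact `optimalParametrization_cusp_cyclotomic_galois` = hypothesis `hG`) + four Mathlib cyclotomic /
Galois modules; theorem-only (kind proof), no `def … : Prop`; no tree or Mathlib declaration bore these two names or statements at landing
(rg + `lean search --decl` 04:2xZ).  HONEST FRAMING as es states it: D3 is a theorem MODULO the named printed fact `hG` only; E-es-185, C2
`ManinOddAtFour`, Manin c = 1 and BSD are NOT proved by this file; C2/C3 OPEN.  bears_on: stmt-BirchSwinnertonDyer-22967.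
-/

set_option autoImplicit false

noncomputable section

open scoped Classical MatrixGroups ModularForm

open CongruenceSubgroup Complex WeierstrassCurve Literature.NumberTheory.EllipticCurves
  Literature.NumberTheory.EllipticCurves.ModularForms
open Summit.BirchSwinnertonDyer.BirchSwinnertonDyer.Theorems.ManinLocalTwoThree

namespace Summit.BirchSwinnertonDyer.Rank1Residual.ManinAdditive.KummerDiamond

section CuspRationality

variable {W₀ : WeierstrassCurve ℚ} [W₀.IsElliptic] {N : ℕ} [NeZero N]

/-- `ℚ(ζ_N) ⊂ ℂ` (`cyclotomicSubfield N`) is an `N`-th cyclotomic extension of `ℚ`. [folklore] -/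
theorem isCyclotomicExtension_cyclotomicSubfield (N : ℕ) [NeZero N] :
    IsCyclotomicExtension {N} ℚ (cyclotomicSubfield N) := by
  have hζ : IsPrimitiveRoot (rootOfUnityExp N) N := Complex.isPrimitiveRoot_exp N (NeZero.ne N)
  have hint : IsIntegral ℚ (rootOfUnityExp N) := (hζ.isIntegral (NeZero.pos N)).tower_top
  change IsCyclotomicExtension {N} ℚ (IntermediateField.adjoin ℚ {rootOfUnityExp N}).toSubalgebra
  rw [IntermediateField.adjoin_simple_toSubalgebra_of_isAlgebraic hint.isAlgebraic]
  exact hζ.adjoin_isCyclotomicExtension ℚ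

/-- **D3 (rationality of the unitary cusp values).**  For a LATTICE-OPTIMAL `X₀(N)`-datum `D₀` of `W₀` and
`N = Q·y` with `gcd(Q, y) = 1`, the value `π₀(c₀·{∞, 1/y}_f)` of the parametrisation at the cusp `1/y` is (the base
change of) a point of `W₀(ℚ)`.  Modulo the named fact `optimalParametrization_cusp_cyclotomic_galois` (hypothesis
`hG`); no other fact. [cite: Stevens1982, §1.3 Thm. 1.3.1 (a), (b)] [folklore] -/
theorem uniformize_modularSymbol_inv_unitary_rational (hG : optimalParametrization_cusp_cyclotomic_galois)
    (D₀ : ModularParametrizationData W₀ N) (hopt : ∀ z ∈ D₀.L.lattice, ∃ w ∈ periodLattice D₀.f, z = D₀.c * w)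
    (Q y : ℕ) (hQy : Q * y = N) (hcop : Nat.Coprime Q y) :
    ∃ P : (W₀.baseChange ℚ).toAffine.Point,
      Affine.Point.baseChange (W' := W₀) ℚ ℂ P = D₀.uniformize ((D₀.c : ℂ) * modularSymbol D₀.f (1 / (y : ℚ))) := by
  haveI hcyc : IsCyclotomicExtension {N} ℚ (cyclotomicSubfield N) := isCyclotomicExtension_cyclotomicSubfield N
  haveI : FiniteDimensional ℚ (cyclotomicSubfield N) := IsCyclotomicExtension.finite {N} ℚ (cyclotomicSubfield N)
  haveI : IsGalois ℚ (cyclotomicSubfield N) := IsCyclotomicExtension.isGalois {N} ℚ (cyclotomicSubfield N)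
  have hN0 : N ≠ 0 := NeZero.ne N
  have hζ : IsPrimitiveRoot (rootOfUnityExp N) N := Complex.isPrimitiveRoot_exp N hN0
  have hζK : IsPrimitiveRoot (zetaGen N) N :=
    hζ.of_map_of_injective (f := algebraMap (cyclotomicSubfield N) ℂ) (algebraMap (cyclotomicSubfield N) ℂ).injective
  -- Stevens (a), (b) at the cusp `1/y`
  obtain ⟨P, hP, hGal⟩ := hG W₀ D₀ hopt 1 (y : ℤ) (by simp [Int.gcd])
  have hP' : Affine.Point.baseChange (W' := W₀) (cyclotomicSubfield N) ℂ P =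
      D₀.uniformize ((D₀.c : ℂ) * modularSymbol D₀.f (1 / (y : ℚ))) := by
    simpa using hP
  -- the value at `1/(d′y)` is the value at `1/y` (transport inside `Γ₀(N)` + Manin relation + `c₀Λ_f ⊆ Λ_E`)
  have htransport : ∀ d' : ℤ, IsCoprime d' (N : ℤ) → d' ≠ 0 →
      D₀.uniformize ((D₀.c : ℂ) * modularSymbol D₀.f (1 / ((d' : ℚ) * y))) =
        D₀.uniformize ((D₀.c : ℂ) * modularSymbol D₀.f (1 / (y : ℚ))) := by
    intro d' hd'cop hd'0
    obtain ⟨γ, -, -, hnum, hden⟩ := exists_gamma0_cusp_transport Q y hQy hcop d' hd'cop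
    have hr : ((γ : SL(2, ℤ)) 1 0 : ℚ) * (1 / (y : ℚ)) + ((γ : SL(2, ℤ)) 1 1 : ℚ) ≠ 0 := by
      rw [hden]; exact_mod_cast hd'0
    have hManin := modularSymbol_gamma0_smul_holds D₀.f γ (1 / (y : ℚ)) hr
    rw [hnum, hden, show (1 / (y : ℚ)) / (d' : ℚ) = 1 / ((d' : ℚ) * y) by rw [div_div, mul_comm]] at hManin
    rw [hManin, mul_add, map_add, (D₀.uniformize_eq_zero_iff _).mpr
      (D₀.smul_periodLattice_le _ (cuspSymbol_mem_periodLattice D₀.f γ)), zero_add]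
  -- every automorphism of `ℚ(ζ_N)` fixes `P`
  have hfix : ∀ σ : cyclotomicSubfield N ≃ₐ[ℚ] cyclotomicSubfield N,
      Affine.Point.map (W' := W₀) (σ : cyclotomicSubfield N →ₐ[ℚ] cyclotomicSubfield N) P = P := by
    intro σ
    have hσζ : IsPrimitiveRoot (σ (zetaGen N)) N := hζK.map_of_injective σ.injective
    have hσζC : IsPrimitiveRoot ((σ (zetaGen N) : cyclotomicSubfield N) : ℂ) N :=
      hσζ.map_of_injective (f := algebraMap (cyclotomicSubfield N) ℂ) (algebraMap (cyclotomicSubfield N) ℂ).injective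
    obtain ⟨d, -, hd⟩ := hζ.eq_pow_of_pow_eq_one hσζC.pow_eq_one
    have hdcop : d.Coprime N := (hζ.pow_iff_coprime (NeZero.pos N) d).mp (hd ▸ hσζC)
    have hσd : ((σ (zetaGen N) : cyclotomicSubfield N) : ℂ) = rootOfUnityExp N ^ d := hd.symm
    apply Affine.Point.map_injective (Algebra.ofId (cyclotomicSubfield N) ℂ)
    change Affine.Point.baseChange (W' := W₀) (cyclotomicSubfield N) ℂ _ =
      Affine.Point.baseChange (W' := W₀) (cyclotomicSubfield N) ℂ P
    rw [hP']
    by_cases hN1 : N = 1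
    · subst hN1
      have h1 := hGal d 1 Int.modEq_one (by simp [Int.gcd]) σ hσd
      simpa using h1
    · obtain ⟨d', hdd'⟩ := Int.mod_coprime hdcop
      have hd'0 : d' ≠ 0 := by
        rintro rfl
        rw [mul_zero] at hdd'
        obtain ⟨m, hm⟩ := hdd'.dvd
        have h1 : (N : ℤ) ∣ 1 := ⟨m, by linear_combination hm⟩
        exact hN1 (by exact_mod_cast Int.eq_one_of_dvd_one (by positivity) h1)
      have hd'cop : IsCoprime d' (N : ℤ) := by
        obtain ⟨m, hm⟩ := hdd'.dvd
        exact ⟨d, m, by linear_combination -hm⟩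
      have h1 := hGal d d' hdd' (by simp [Int.gcd]) σ hσd
      rw [h1, ← htransport d' hd'cop hd'0]
      push_cast
      ring_nf
  -- Galois descent of the coordinates
  rcases P with _ | ⟨x, w, hxw⟩
  · refine ⟨0, ?_⟩
    rw [show (Affine.Point.zero : (W₀.baseChange (cyclotomicSubfield N)).toAffine.Point) = 0 from rfl,
      map_zero] at hP'
    rw [map_zero]
    exact hP'
  · have hx : ∀ σ : cyclotomicSubfield N ≃ₐ[ℚ] cyclotomicSubfield N, σ x = x := fun σ => by
      have h := hfix σ
      rw [Affine.Point.map_some] at h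
      exact (Affine.Point.some.inj h).1
    have hw : ∀ σ : cyclotomicSubfield N ≃ₐ[ℚ] cyclotomicSubfield N, σ w = w := fun σ => by
      have h := hfix σ
      rw [Affine.Point.map_some] at h
      exact (Affine.Point.some.inj h).2
    obtain ⟨qx, hqx⟩ := (IsGalois.mem_range_algebraMap_iff_fixed x).mpr hx
    obtain ⟨qw, hqw⟩ := (IsGalois.mem_range_algebraMap_iff_fixed w).mpr hw
    subst hqx hqw
    have h₀ : (W₀.baseChange ℚ).toAffine.Nonsingular qx qw :=
      (WeierstrassCurve.Affine.baseChange_nonsingular (W₀ : WeierstrassCurve.Affine ℚ)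
        (f := Algebra.ofId ℚ (cyclotomicSubfield N))
        (fun a b h => (algebraMap ℚ (cyclotomicSubfield N)).injective h) qx qw).mp hxw
    refine ⟨.some _ _ h₀, ?_⟩
    rw [← hP', ← Affine.Point.map_baseChange (W' := W₀) (IntermediateField.val (cyclotomicSubfield N))
      (.some _ _ h₀)]
    rfl

end CuspRationality

end Summit.BirchSwinnertonDyer.Rank1Residual.ManinAdditive.KummerDiamond

end
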